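import Mathlib
import Summits.Ventures.PercRepro.TriangleCapHungK4
import Summits.Ventures.PercRepro.TriangleCapFourRowTwoStrict

/-!
# PercRepro — THE NON-BIPARTITE SECOND-ORDER LOCUS OF THE CELL `(k, 4, 2)`: for `k ≥ 11`, the non-`4`-bipartite
`K₄⁻`-free graphs with `4 (k − 4) − 2` edges at the value `m k − 2 (k − 3) − 2 (k − 9)` are EXACTLY the hung
`K_{4,k−5}` — a vertex of degree `2` on an edge of `K_{4,k−5}` (p3, gen 45; part 201b)

Part 198b's degree argument tracked at equality with the pieces of parts 201a/201a′: a vertex `z` of degree `2` is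
deleted onto the diagonal `(k − 1, 4, 0)` (`diag_second_order_all`) — `D − z = K_{4,k−5}` with the neighbours of
`z` in `A′` (`4`-bipartite), both off `A′` (strictly below, `T(z) ≤ 8`) or on opposite sides (`HungK4`); or
`D − z` is `8 (k − 10)` below, strictly (`four_two_del_two_locus`); a vertex of degree `3` is strictly below
(`four_two_del_three_strict`, the `K₄⁻`-refinement), so is one of degree `≤ 1` (`four_two_cross_strict'`); with
every degree `≥ 4` the cap makes `D` `4`-bipartite (`four_two_cap_strict`) and the convexity is strict
(`four_two_convex_strict`). Hence `four_two_nonbip_second_locus`, and on `Fin k` the equivalence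
`four_two_nonbip_second_best_maximisers`. (At `k = 10` the value `T = 2` is the parity bound and the cap count
allows a triangle on the three non-neighbours; not claimed.) Axioms: standard.
-/

namespace PercRepro

namespace TriangleCap

namespace C047

open Finset

variable {V : Type*} [Fintype V] [DecidableEq V]

/-- The arithmetic of the degree-`2` deletion onto `K_{4,k−5}` with both neighbours off the small side: `10 ≤ k`,
`m + 2 = 4 (k − 4)`, `m′ + 2 = m`, `S′ = m′ (k − 1)`, `T ≤ 8` ⇒ strictly below. -/
theorem four_two_del_two_off_arith (k m m' S' T : ℕ) (hk : 10 ≤ k) (hm : m + 2 = 4 * (k - 4)) (hm' : m' + 2 = m)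
    (hS' : S' = m' * (k - 1)) (hT : T ≤ 8) :
    S' + 2 * T + 2 + 2 * 2 + 2 * (k - 3) + 2 * (k - 9) + 2 ≤ m * k := by
  obtain ⟨t, rfl⟩ : ∃ t, k = t + 10 := ⟨k - 10, by omega⟩
  have hm1 : m = 4 * t + 22 := by omega
  have hm2 : m' = 4 * t + 20 := by omega
  subst hm1 hm2 hS'
  have e1 : t + 10 - 1 = t + 9 := by omega
  have e2 : t + 10 - 3 = t + 7 := by omega
  have e3 : t + 10 - 9 = t + 1 := by omega
  rw [e1, e2, e3]
  nlinarith [hT]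

/-- The arithmetic of the degree-`2` deletion onto a non-`4`-bipartite `D − z`, strict, the neighbours at `≤ k − 5`
in `D − z`: room `6k − 64 ≥ 2` for `k ≥ 11`. -/
theorem four_two_del_two_gap_strict_arith (k m m' S' T : ℕ) (hk : 11 ≤ k) (hm : m + 2 = 4 * (k - 4))
    (hm' : m' + 2 = m) (hS' : S' + 2 * 4 * (k - 1 - 2 * 4 - 1) ≤ m' * (k - 1)) (hT : T ≤ 2 * (k - 5)) :
    S' + 2 * T + 2 + 2 * 2 + 2 * (k - 3) + 2 * (k - 9) + 2 ≤ m * k := by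
  obtain ⟨t, rfl⟩ : ∃ t, k = t + 11 := ⟨k - 11, by omega⟩
  have hm1 : m = 4 * t + 26 := by omega
  have hm2 : m' = 4 * t + 24 := by omega
  subst hm1 hm2
  have e1 : t + 11 - 1 = t + 10 := by omega
  have e2 : t + 11 - 1 - 2 * 4 - 1 = t + 1 := by omega
  have e3 : t + 11 - 3 = t + 8 := by omega
  have e4 : t + 11 - 9 = t + 2 := by omega
  have e5 : t + 11 - 5 = t + 6 := by omega
  rw [e2, e1] at hS'
  rw [e5] at hT
  rw [e3, e4]
  nlinarith [hS', hT]

/-- **A VERTEX OF DEGREE `2` ON THE CELL `(k, 4, 2)`, `11 ≤ k`, EVERY DEGREE `≤ k − 4`:** `D` is `4`-bipartite, or a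
hung `K_{4,k−5}`, or strictly below the non-bipartite second-best value. -/
theorem four_two_del_two_locus (D : SimpleGraph V) [DecidableRel D.Adj] (hK : K4mFree D)
    (hk : 11 ≤ Fintype.card V) (hm : D.edgeFinset.card + 2 = 4 * (Fintype.card V - 4))
    (hcap : ∀ v, deg D v + 4 ≤ Fintype.card V) (z : V) (hz : deg D z = 2) :
    (∃ A : Finset V, A.card = 4 ∧ BipSub D A) ∨ HungK4 D ∨
      ∑ v, deg D v * deg D v + 2 * (Fintype.card V - 3) + 2 * (Fintype.card V - 9) + 2 ≤
        D.edgeFinset.card * Fintype.card V := by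
  have hK' := k4mFree_del D hK z
  have hcard' := card_del z
  have hedges' := card_edges_del D z
  have hsq := sum_deg_sq_del D z
  rw [hz] at hedges' hsq
  obtain ⟨k, hk'⟩ : ∃ k, Fintype.card V = k := ⟨_, rfl⟩
  have hcardW' : Fintype.card {v : V // v ≠ z} = k - 1 := by omega
  obtain ⟨m, hmdef⟩ : ∃ m, D.edgeFinset.card = m := ⟨_, rfl⟩
  obtain ⟨m', hm'def⟩ : ∃ m', (del D z).edgeFinset.card = m' := ⟨_, rfl⟩
  rw [hmdef] at hedges' hm
  rw [hm'def] at hedges'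
  rw [hk'] at hm hk hcap
  have hm' : (del D z).edgeFinset.card = 4 * (Fintype.card {v : V // v ≠ z} - 4) := by
    rw [hm'def, hcardW']
    have e : 4 * (k - 4) = 4 * (k - 1 - 4) + 4 := by omega
    omega
  obtain ⟨T, hTdef⟩ : ∃ T, ∑ w : {v : V // v ≠ z}, (if D.Adj w.1 z then deg (del D z) w else 0) = T := ⟨_, rfl⟩
  obtain ⟨S', hS'def⟩ : ∃ S', ∑ w : {v : V // v ≠ z}, deg (del D z) w * deg (del D z) w = S' := ⟨_, rfl⟩
  rw [hTdef, hS'def] at hsq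
  rcases diag_second_order_all (del D z) hK' 4 (by norm_num) (by omega) hm' with ⟨A', hA'card, hA'⟩ | hgap
  · by_cases hin : ∀ w : {v : V // v ≠ z}, D.Adj w.1 z → w ∈ A'
    · obtain ⟨B, hBcard, hB⟩ := bipSub_lift D z A' hA' hin
      exact Or.inl ⟨B, by rw [hBcard, hA'card], hB⟩
    push Not at hin
    obtain ⟨w₀, hw₀, hw₀A⟩ := hin
    by_cases hin2 : ∃ w : {v : V // v ≠ z}, D.Adj w.1 z ∧ w ∈ A'
    · obtain ⟨w, hw, hwA⟩ := hin2
      exact Or.inr (Or.inl ⟨z, A', hz, hA'card, hA', hm', w, w₀, hwA, hw₀A, hw, hw₀⟩)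
    · right; right
      push Not at hin2
      have hT : T ≤ 8 := by
        rw [← hTdef]
        have h1 : ∑ w : {v : V // v ≠ z}, (if D.Adj w.1 z then deg (del D z) w else 0) ≤
            ∑ w : {v : V // v ≠ z}, (if D.Adj w.1 z then 4 else 0) := by
          apply sum_le_sum
          intro w _
          by_cases h : D.Adj w.1 z
          · simp only [h, if_true]
            have := deg_le_card_of_bipSub (del D z) A' hA' w (hin2 w h)
            rw [hA'card] at this
            exact this
          · simp only [h, if_false]
            exact le_refl 0
        rw [sum_del_nbhd_const D z 4, hz] at h1
        exact h1
      haveI : Nonempty {v : V // v ≠ z} := Fintype.card_pos_iff.mp (by omega)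
      have hS' := sum_deg_sq_eq_of_bipSub_full (del D z) A' 4 hA'card hA' hm' inferInstance
      rw [hS'def, hm'def, hcardW'] at hS'
      rw [hsq, hmdef, hk']
      exact four_two_del_two_off_arith k m m' S' T (by omega) hm hedges' hS' hT
  · right; right
    have hT := sum_del_nbhd_le D z (k - 5) (fun v => by have := hcap v; omega)
    rw [hTdef, hz] at hT
    rw [hS'def, hm'def, hcardW'] at hgap
    rw [hsq, hmdef, hk']
    exact four_two_del_two_gap_strict_arith k m m' S' T hk hm hedges' hgap hT

/-- **THE NON-BIPARTITE SECOND-ORDER LOCUS OF THE CELL `(k, 4, 2)`, `k ≥ 11`:** a `K₄⁻`-free graph with `4 (k − 4) − 2`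
edges that is not `4`-bipartite and attains `Σ_v d(v)² + 2 (k − 3) + 2 (k − 9) = m k` is a hung `K_{4,k−5}`. -/
theorem four_two_nonbip_second_locus (D : SimpleGraph V) [DecidableRel D.Adj] (hK : K4mFree D)
    (hk : 11 ≤ Fintype.card V) (hm : D.edgeFinset.card + 2 = 4 * (Fintype.card V - 4))
    (hnb : ¬ ∃ A : Finset V, A.card = 4 ∧ BipSub D A)
    (heq : ∑ v, deg D v * deg D v + 2 * (Fintype.card V - 3) + 2 * (Fintype.card V - 9) =
      D.edgeFinset.card * Fintype.card V) :
    HungK4 D := by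
  -- the max-degree cap: every degree is `≤ k − 4`
  have hcap : ∀ v, deg D v + 4 ≤ Fintype.card V := fun v =>
    deg_add_le_card_of_dense D hK 4 (by omega) (by omega)
      (cap_arith 4 (Fintype.card V) D.edgeFinset.card 2 (by omega) (by omega)
        (below_cap_arith 4 (Fintype.card V) D.edgeFinset.card 2 (by omega) hm)) v
  by_cases hsmall : ∃ z, deg D z ≤ 3
  · obtain ⟨z, hz⟩ := hsmall
    rcases Nat.lt_or_ge (deg D z) 2 with hz1 | hz2
    · exfalso
      have := four_two_cross_strict' D hK hk hm hcap z (by omega)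
      omega
    rcases Nat.lt_or_ge (deg D z) 3 with hz2' | hz3
    · rcases four_two_del_two_locus D hK hk hm hcap z (by omega) with h | h | h
      · exact absurd h hnb
      · exact h
      · exfalso
        omega
    · exfalso
      rcases four_two_del_three_strict D hK hk hm hcap z (by omega) with h | h
      · exact hnb h
      · omega
  · push Not at hsmall
    exfalso
    by_cases hx : ∃ x, deg D x + 4 = Fintype.card V
    · obtain ⟨x, hx⟩ := hx
      exact hnb (four_two_cap_strict D hK hk hm (fun v => by have := hsmall v; omega) x hx)
    · push Not at hx
      have hcap' : ∀ v, deg D v + 5 ≤ Fintype.card V := fun v => by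
        have h1 := hcap v
        have h2 := hx v
        omega
      have := four_two_convex_strict D (by omega) hm hcap' (fun v => by have := hsmall v; omega)
      omega

/-- **THE NON-BIPARTITE SECOND-BEST GRAPHS OF THE CELL `(k, 4, 2)`, `k ≥ 11`, ON `Fin k`:** a non-`4`-bipartite
`K₄⁻`-free graph with `4 (k − 4) − 2` edges attains `Σ_v d(v)² + 2 (k − 3) + 2 (k − 9) = m k` iff it is a hung
`K_{4,k−5}`. -/
theorem four_two_nonbip_second_best_maximisers (k : ℕ) (hk : 11 ≤ k) (D : SimpleGraph (Fin k))
    [DecidableRel D.Adj] (hK : K4mFree D) (hm : D.edgeFinset.card + 2 = 4 * (k - 4))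
    (hnb : ¬ ∃ A : Finset (Fin k), A.card = 4 ∧ BipSub D A) :
    ∑ v, deg D v * deg D v + 2 * (k - 3) + 2 * (k - 9) = D.edgeFinset.card * k ↔ HungK4 D := by
  have hcard : Fintype.card (Fin k) = k := Fintype.card_fin k
  constructor
  · intro heq
    exact four_two_nonbip_second_locus D hK (by rw [hcard]; exact hk) (by rw [hcard]; exact hm) hnb
      (by rw [hcard]; exact heq)
  · intro hH
    have := (hungK4_value D (by rw [hcard]; omega) hH).2.1
    rw [hcard] at this
    exact this

end C047

end TriangleCap

end PercRepro
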